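import Literature.AlgebraicGeometry.HodgeTheory.FermatAokiSubvarietyCodimension
import Literature.AlgebraicGeometry.Motives.ProjBasicOpenSubscheme
import Literature.AlgebraicGeometry.Motives.VarietiesProjectiveSpaceProofs
import Literature.AlgebraicGeometry.Motives.SubschemeCyclesFundamentalProofs
import Literature.RingTheory.KrullDimension.AffineCatenary
import Literature.NumberTheory.Transcendental.AnalytificationProjProofs
import Mathlib.RingTheory.Ideal.KrullsHeightTheorem
import Mathlib.RingTheory.KrullDimension.NonZeroDivisors
import Mathlib.RingTheory.Polynomial.Vieta
import Mathlib.RingTheory.RootsOfUnity.PrimitiveRoots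
import HarnessLib

/-!
# Aoki's subvariety `Y ⊂ X^{p-1}ₘ` has an `r`-dimensional point: the projective dimension theorem for its `r + 1` equations

Family `hodge`, layer `Literature/AlgebraicGeometry/HodgeTheory`. PROOF FILE (sequel of
`FermatAokiSubvarietyCodimension`; theorems only, no definition, no named fact) for the leaf
`Aoki1987_thm_2_1_supportedClass` of the named fact `Aoki1987_claim_pStandard` — N. Aoki, *Some new
algebraic cycles on Fermat varieties*, J. Math. Soc. Japan 39 (1987) 385–396, THEOREM 2-1 (p. 388):
"The variety `Y` defined by (2.1) is a subvariety of `X^{p-1}ₘ` of codimension `r` …", PROP. 3-1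
(p. 389). `FermatAokiSubvarietyCodimension` proved the upper bound `dim ≤ r` at every point of
`Y ∩ X²ʳₘ` (`codim ≥ r`); this file proves the LOWER bound in the form needed to know that the
`r`-cycle `[Y]` of Aoki's `Y` (`FermatAokiSubvarietyCycle`) is not zero: `Y ∩ X²ʳₘ` has a point of
dimension exactly `r` (`Aoki1987.exists_mem_fermatAokiSection_height_eq`, for `m = pd`, `cᵈ = -p`).

* `exists_specializes_le_height_of_mem_zeroLocus` — **the projective dimension theorem, lower
  bound** (Hartshorne I Thm. 7.2 / Prop. 7.1): every point of `V₊(f₁, …, f_s) ⊆ ℙᴺ_k` (forms of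
  positive degree over a field) is a specialisation of a point of `V₊(f₁, …, f_s)` of dimension
  `≥ N - s`. Proof on an affine chart `D₊(xᵢ) = Spec k[x₀/xᵢ, …]` (`ProjectiveSpace.chartAlgEquiv`,
  Mathlib `Proj.awayι`, the tree's `ProjSubscheme.awayι_preimage_zeroLocus`): Krull's height
  theorem (Mathlib `Ideal.height_le_card_of_mem_minimalPrimes_span_finset`) and the dimension
  formula for affine domains (`Literature.RingTheory.KrullDimension.ringKrullDim_quotient_add_height`),
  with `height_spec_eq_ringKrullDim_quotient` (dimension of the closure of a point of `Spec B` is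
  `dim B/𝔮`) and `strictMono_base_of_isOpenImmersion`.
* `esymm_pow_primitiveRoot_eq_zero` — Vieta: `e_k(1, ω, …, ω^{p-1}) = 0` (`0 < k < p`) for a
  primitive `p`-th root of unity `ω`; `Aoki1987.exists_eval_aokiEquations_eq_zero` — the point
  `(1 : ξ : ⋯ : ξ^{p-1} : t)` of `Y` (`ξ = e^{2πi/m}`; cf. the points `P_t` of p. 390);
  `Aoki1987.exists_isHomogeneous_of_mem_aokiEquations` — the equations (2.1) are forms of positive
  degree.
* **`Aoki1987.exists_mem_fermatAokiSection_height_eq`** — for `r, d ≥ 1`, `m = (2r+1)d`,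
  `cᵈ = -(2r+1)`: some `z ∈ Y ∩ X²ʳₘ` has `dim {z}⁻ = r = codim {z}⁻`.

## References

* [Aoki1987] N. Aoki, Some new algebraic cycles on Fermat varieties, J. Math. Soc. Japan 39 (1987)
  385–396: (2.1) and Thm. 2-1 (p. 388), Prop. 3-1 (p. 389), p. 390 (the points `P_t`).
* [Hartshorne1977] R. Hartshorne, Algebraic Geometry, GTM 52 (1977): I Prop. 7.1, I Thm. 7.2,
  II Prop. 2.5 (b), II Ex. 3.20.
* [Matsumura1987] H. Matsumura, Commutative Ring Theory, Thm 5.6, Thm 13.5.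
-/

noncomputable section

open CategoryTheory AlgebraicGeometry MvPolynomial Finset Order HomogeneousLocalization

universe u

namespace Literature.AlgebraicGeometry.HodgeTheory

open Literature.AlgebraicGeometry.Motives

/-! ### Heights of points of `Spec B` and open immersions -/

section SpecHeight

/-- In `Spec B` (specialisation order `a ≤ b ↔ b ⤳ a`), the dimension of the closure of a point `q`
is the Krull dimension of `B ⧸ q`. [folklore] -/
theorem height_spec_eq_ringKrullDim_quotient (B : CommRingCat.{u}) (q : Spec B) :
    ((Order.height q : ℕ∞) : WithBot ℕ∞) = ringKrullDim (B ⧸ q.asIdeal) := by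
  let q' : PrimeSpectrum B := q
  have h1 : Order.height q = Order.coheight q' := by
    have h := Order.height_orderIso (specOrderIsoPrimeSpectrum B) q
    rw [specOrderIsoPrimeSpectrum_apply, Order.height_toDual] at h
    exact h.symm
  have h2 : Set.Ici q' = PrimeSpectrum.zeroLocus (q'.asIdeal : Set B) := by
    ext p
    rw [Set.mem_Ici, PrimeSpectrum.mem_zeroLocus, SetLike.coe_subset_coe,
      PrimeSpectrum.asIdeal_le_asIdeal]
  rw [h1, Order.coheight_eq_krullDim_Ici, show q.asIdeal = q'.asIdeal from rfl, ringKrullDim_quotient,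
    Order.krullDim_eq_of_orderIso (OrderIso.setCongr _ _ h2)]

/-- An open immersion is strictly monotone on points for the specialisation orders (it preserves
and reflects specialisation, being a topological embedding). [folklore] -/
theorem strictMono_base_of_isOpenImmersion {U V : Scheme.{u}} (f : U ⟶ V) [IsOpenImmersion f] :
    StrictMono f.base := by
  intro a b hab
  rw [lt_iff_le_not_ge] at hab ⊢
  refine ⟨Scheme.le_iff_specializes.2 ((Scheme.le_iff_specializes.1 hab.1).map f.continuous),
    fun h ↦ hab.2 (Scheme.le_iff_specializes.2 ?_)⟩
  exact f.isOpenEmbedding.isInducing.specializes_iff.1 (Scheme.le_iff_specializes.1 h)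

end SpecHeight

/-! ### The projective dimension theorem: points of `V₊(f₁, …, f_s) ⊆ ℙᴺ` below dimension `N - s` generise -/

section ProjectiveDimension

variable {k : Type u} [Field k] {N : ℕ}

/-- **The projective dimension theorem (lower bound).** Let `S` be a finite set of forms of positive
degrees in `k[x₀, …, x_N]`, `k` a field. Every point `w₀` of `V₊(S) ⊆ ℙᴺ_k` is a specialisation of
a point `w ∈ V₊(S)` of dimension `≥ N - |S|` ("every irreducible component of `V₊(f₁, …, f_s)` has
dimension `≥ N - s`", Hartshorne I Thm. 7.2 / Ex. I.1.8–1.9). Proof on the chart `D₊(xᵢ) ∋ w₀`,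
`D₊(xᵢ) = Spec k[x₀/xᵢ, …, x_N/xᵢ]` (`ProjectiveSpace.chartAlgEquiv`): a minimal prime `𝔮` of the
dehomogenised equations below the prime of `w₀` has height `≤ |S|` (Krull's height theorem,
Mathlib `Ideal.height_le_card_of_mem_minimalPrimes_span_finset`), so
`dim k[y]/𝔮 = N - height 𝔮 ≥ N - |S|` (dimension formula for affine domains,
`Literature.RingTheory.KrullDimension.ringKrullDim_quotient_add_height`), and the open immersion
`Spec k[y] → ℙᴺ` does not decrease dimensions of closures of points.
[cite: Hartshorne1977, I Thm. 7.2 and I Prop. 7.1] -/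
theorem exists_specializes_le_height_of_mem_zeroLocus (S : Finset (MvPolynomial (Fin (N + 1)) k))
    (e : MvPolynomial (Fin (N + 1)) k → ℕ) (hS : ∀ s ∈ S, 0 < e s ∧ s.IsHomogeneous (e s))
    (i : Fin (N + 1)) :
    letI := MvPolynomial.gradedAlgebra (σ := Fin (N + 1)) (R := k)
    ∀ {w₀ : ↥(projectiveSpace N k).left},
      w₀ ∈ ProjectiveSpectrum.zeroLocus (MvPolynomial.homogeneousSubmodule (Fin (N + 1)) k)
        (S : Set (MvPolynomial (Fin (N + 1)) k)) →
      (X i : MvPolynomial (Fin (N + 1)) k) ∉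
        (w₀ : ProjectiveSpectrum (MvPolynomial.homogeneousSubmodule (Fin (N + 1)) k)).asHomogeneousIdeal →
    ∃ w : ↥(projectiveSpace N k).left,
      w ∈ ProjectiveSpectrum.zeroLocus (MvPolynomial.homogeneousSubmodule (Fin (N + 1)) k)
          (S : Set (MvPolynomial (Fin (N + 1)) k)) ∧
        w ⤳ w₀ ∧ ((N - S.card : ℕ) : ℕ∞) ≤ Order.height w := by
  letI := MvPolynomial.gradedAlgebra (σ := Fin (N + 1)) (R := k)
  intro w₀ hw₀ hi
  classical
  -- notation
  let 𝒜 := MvPolynomial.homogeneousSubmodule (Fin (N + 1)) k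
  have f_deg : (X i : MvPolynomial (Fin (N + 1)) k) ∈ 𝒜 1 := ProjectiveSpace.X_mem i
  let B : Type u := Away 𝒜 (X i : MvPolynomial (Fin (N + 1)) k)
  letI : Algebra k B := Motives.ProjBaseChange.algebraBase 𝒜 (Submonoid.powers (X i))
  let ι : Spec (CommRingCat.of B) ⟶ Proj 𝒜 := Proj.awayι 𝒜 (X i) f_deg one_pos
  -- the chart algebra is a polynomial ring in `N` variables
  let eB : B ≃ₐ[k] MvPolynomial (Fin N) k := ProjectiveSpace.chartAlgEquiv k i
  haveI : IsDomain B := MulEquiv.isDomain (MvPolynomial (Fin N) k) eB.toMulEquiv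
  haveI : IsNoetherianRing B := isNoetherianRing_of_ringEquiv _ eB.symm.toRingEquiv
  haveI : Algebra.FiniteType k B :=
    (inferInstance : Algebra.FiniteType k (MvPolynomial (Fin N) k)).equiv eB.symm
  have hdimB : ringKrullDim B = (N : ℕ) := by
    rw [ringKrullDim_eq_of_ringEquiv eB.toRingEquiv, MvPolynomial.ringKrullDim_of_isNoetherianRing,
      ringKrullDim_eq_zero_of_field, Nat.card_eq_fintype_card, Fintype.card_fin, zero_add]
  -- the dehomogenised equations
  have hdeg : ∀ s ∈ S, s ∈ 𝒜 (e s) := fun s hs ↦ (mem_homogeneousSubmodule _ _).mpr (hS s hs).2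
  let sB : ↥S → B := fun s ↦ Away.isLocalizationElem f_deg (hdeg s.1 s.2)
  let T : Finset B := Finset.univ.image sB
  have hTcard : T.card ≤ S.card :=
    Finset.card_image_le.trans (by rw [Finset.card_univ, Fintype.card_coe])
  let J : Ideal B := Ideal.span (T : Set B)
  -- `ι⁻¹ V₊(s) = V(s/xᵢ^{e s})`
  have hpre : ∀ s : ↥S, ∀ q : Spec (CommRingCat.of B),
      ι.base q ∈ ProjectiveSpectrum.zeroLocus 𝒜 {(s.1 : MvPolynomial (Fin (N + 1)) k)} ↔
        sB s ∈ q.asIdeal := by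
    intro s q
    have key := ProjSubscheme.awayι_preimage_zeroLocus 𝒜 f_deg one_pos (hdeg s.1 s.2) (hS s.1 s.2).1
    have hq := Set.ext_iff.mp key q
    exact hq.trans ((PrimeSpectrum.mem_zeroLocus _ _).trans Set.singleton_subset_iff)
  -- `w₀ = ι q₀`
  have hw₀U : w₀ ∈ ι.opensRange := by
    rw [Proj.opensRange_awayι]
    exact (ProjectiveSpectrum.mem_basicOpen 𝒜 _ _).mpr hi
  obtain ⟨q₀, hq₀⟩ := (Scheme.Hom.mem_opensRange).1 hw₀U
  have hJq₀ : J ≤ q₀.asIdeal := by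
    rw [Ideal.span_le]
    intro t ht
    obtain ⟨s, -, rfl⟩ := Finset.mem_image.1 (Finset.mem_coe.1 ht)
    refine (hpre s q₀).1 ?_
    have h0 : ι.base q₀ = w₀ := hq₀
    rw [h0]
    exact ProjectiveSpectrum.zeroLocus_anti_mono (𝒜 := 𝒜)
      (Set.singleton_subset_iff.mpr (Finset.mem_coe.mpr s.2)) hw₀
  -- a minimal prime `𝔮 ≤ q₀` of `J`; Krull: `height 𝔮 ≤ |S|`
  obtain ⟨𝔮, h𝔮min, h𝔮q₀⟩ := Ideal.exists_minimalPrimes_le hJq₀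
  haveI h𝔮 : 𝔮.IsPrime := h𝔮min.1.1
  have hJ𝔮 : J ≤ 𝔮 := h𝔮min.1.2
  have hht : 𝔮.height ≤ S.card :=
    (Ideal.height_le_card_of_mem_minimalPrimes_span_finset h𝔮min).trans (by exact_mod_cast hTcard)
  -- dimension formula: `dim B/𝔮 + height 𝔮 = N`
  have hformula := Literature.RingTheory.KrullDimension.ringKrullDim_quotient_add_height k 𝔮
  rw [hdimB] at hformula
  -- the point `w = ι 𝔮`
  let q : Spec (CommRingCat.of B) := ⟨𝔮, h𝔮⟩
  have hq : ((Order.height q : ℕ∞) : WithBot ℕ∞) = ringKrullDim (B ⧸ 𝔮) :=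
    height_spec_eq_ringKrullDim_quotient (CommRingCat.of B) q
  refine ⟨ι.base q, ?_, ?_, ?_⟩
  · -- `w ∈ V₊(S)`
    refine (ProjectiveSpectrum.mem_zeroLocus _ _ _).2 fun s hs ↦ ?_
    have h1 : ι.base q ∈ ProjectiveSpectrum.zeroLocus 𝒜 {s} :=
      (hpre ⟨s, hs⟩ q).2 (hJ𝔮 (Ideal.subset_span (Finset.mem_coe.mpr
        (Finset.mem_image_of_mem sB (Finset.mem_univ _)))))
    exact (ProjectiveSpectrum.mem_zeroLocus _ _ _).1 h1 (Set.mem_singleton s)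
  · -- `w ⤳ w₀`
    have h0 : ι.base q₀ = w₀ := hq₀
    rw [← h0]
    refine Specializes.map ?_ ι.continuous
    have hspec : (⟨𝔮, h𝔮⟩ : PrimeSpectrum B) ⤳ (q₀ : PrimeSpectrum B) :=
      (PrimeSpectrum.le_iff_specializes _ q₀).1 h𝔮q₀
    exact hspec
  · -- `height w ≥ height q = dim B/𝔮 = N - height 𝔮 ≥ N - |S|`
    refine le_trans ?_ (Order.height_le_height_apply_of_strictMono _
      (strictMono_base_of_isOpenImmersion ι) q)
    rw [← hq] at hformula
    -- `height q + height 𝔮 = N` in `ℕ∞`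
    have hsum : Order.height q + 𝔮.height = (N : ℕ∞) := by
      apply WithBot.coe_inj.mp
      push_cast
      exact hformula
    rw [ENat.coe_sub, tsub_le_iff_right, ← hsum]
    exact add_le_add_right hht _

end ProjectiveDimension

/-! ### Vieta: the elementary symmetric functions of the `p`-th roots of unity vanish -/

section Vieta

/-- **`e_k(1, ω, …, ω^{p-1}) = 0` for `0 < k < p`** and `ω` a primitive `p`-th root of unity in
`ℂ`: `∏_{j<p} (T - ωʲ) = Tᵖ - 1` (Vieta, Mathlib `Polynomial.coeff_eq_esymm_roots_of_card` for
`Tᵖ - 1`, whose roots are the `ωʲ`, `IsPrimitiveRoot.nthRoots_eq`). [folklore] -/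
theorem esymm_pow_primitiveRoot_eq_zero {p : ℕ} {ω : ℂ} (hω : IsPrimitiveRoot ω p) {k : ℕ}
    (hk : 0 < k) (hkp : k < p) :
    ((Finset.univ : Finset (Fin p)).val.map fun j : Fin p ↦ ω ^ (j : ℕ)).esymm k = 0 := by
  classical
  have hp : 0 < p := lt_of_le_of_lt (Nat.zero_le _) hkp
  -- the multiset `{ωʲ : j < p}` is the multiset of `p`-th roots of `1`
  have hM : ((Finset.univ : Finset (Fin p)).val.map fun j : Fin p ↦ ω ^ (j : ℕ)) =
      Polynomial.nthRoots p (1 : ℂ) := by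
    rw [hω.nthRoots_eq (α := 1) (one_pow p), Fin.univ_val_map, List.ofFn_eq_map]
    simp only [mul_one]
    rw [show (Multiset.range p) = ((List.range p : List ℕ) : Multiset ℕ) from rfl,
      ← List.map_coe_finRange_eq_range, Multiset.map_coe, List.map_map]
    rfl
  -- Vieta for `Tᵖ - 1`
  set P : Polynomial ℂ := Polynomial.X ^ p - Polynomial.C 1 with hP
  have hroots : P.roots = Polynomial.nthRoots p (1 : ℂ) := rfl
  have hdeg : P.natDegree = p := Polynomial.natDegree_X_pow_sub_C
  have hmonic : P.Monic := Polynomial.monic_X_pow_sub_C (1 : ℂ) hp.ne'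
  have hcard : Multiset.card P.roots = P.natDegree := by
    rw [hroots, hdeg]; exact hω.card_nthRoots_one
  have hV := Polynomial.coeff_eq_esymm_roots_of_card hcard (k := p - k) (by rw [hdeg]; omega)
  rw [hmonic.leadingCoeff, one_mul, hdeg, show p - (p - k) = k by omega, hroots, ← hM] at hV
  -- the coefficient of `T^{p-k}` in `Tᵖ - 1` vanishes
  have hcoeff : P.coeff (p - k) = 0 := by
    rw [hP, Polynomial.coeff_sub, Polynomial.coeff_X_pow, Polynomial.coeff_C, if_neg (by omega),
      if_neg (by omega), sub_zero]
  rw [hcoeff] at hV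
  have hunit : ((-1 : ℂ) ^ k) ≠ 0 := pow_ne_zero _ (neg_ne_zero.mpr one_ne_zero)
  exact (mul_eq_zero.mp hV.symm).resolve_left hunit

end Vieta

/-! ### Aoki's `Y` has an `r`-dimensional point -/

/-- `e_k` is homogeneous of degree `k` (each monomial `∏_{i ∈ t} xᵢ`, `|t| = k`, is).
[folklore] -/
theorem esymm_isHomogeneous' {σ : Type*} [Fintype σ] (R : Type*) [CommSemiring R] (k : ℕ) :
    (esymm σ R k).IsHomogeneous k := by
  classical
  rw [MvPolynomial.esymm]
  refine IsHomogeneous.sum _ _ _ fun t ht ↦ ?_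
  have hcard : t.card = k := (Finset.mem_powersetCard.1 ht).2
  have h := IsHomogeneous.prod t (fun i ↦ (X i : MvPolynomial σ R)) (fun _ ↦ 1)
    fun i _ ↦ isHomogeneous_X R i
  simpa [hcard] using h

namespace Aoki1987

variable {m r d : ℕ}

/-- The Aoki equations (2.1) are forms of positive degree: `f₀ = x_pᵖ - c·x₀⋯x_{p-1}` has degree
`p = 2r + 1`, `e_k(x₀ᵈ, …, x_{p-1}ᵈ)` (`1 ≤ k ≤ r`) has degree `d k` (`d ≥ 1`).
[cite: Aoki1987, (2.1) (p. 388)] -/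
theorem exists_isHomogeneous_of_mem_aokiEquations (hd : 0 < d) (c : ℂ)
    {g : MvPolynomial (Fin (2 * r + 2)) ℂ} (hg : g ∈ aokiEquations r d c) :
    ∃ e, 0 < e ∧ g.IsHomogeneous e := by
  rcases Set.mem_insert_iff.mp hg with rfl | hg'
  · refine ⟨2 * r + 1, by omega, ?_⟩
    have h1 : (X (Fin.last (2 * r + 1)) ^ (2 * r + 1) :
        MvPolynomial (Fin (2 * r + 2)) ℂ).IsHomogeneous (2 * r + 1) :=
      isHomogeneous_X_pow _ _
    have hprod : (∏ i : Fin (2 * r + 1), X (Fin.castSucc i) :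
        MvPolynomial (Fin (2 * r + 2)) ℂ).IsHomogeneous (∑ _i : Fin (2 * r + 1), 1) :=
      IsHomogeneous.prod _ _ _ fun i _ ↦ isHomogeneous_X ℂ (Fin.castSucc i)
    rw [Finset.sum_const, Finset.card_univ, Fintype.card_fin, smul_eq_mul, mul_one] at hprod
    have h2 : (C c * ∏ i : Fin (2 * r + 1), X (Fin.castSucc i) :
        MvPolynomial (Fin (2 * r + 2)) ℂ).IsHomogeneous (2 * r + 1) := by
      simpa using (isHomogeneous_C _ c).mul hprod
    exact h1.sub h2
  · obtain ⟨j, hj, rfl⟩ := hg'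
    refine ⟨d * j, Nat.mul_pos hd hj.1, ?_⟩
    beta_reduce
    rw [MvPolynomial.aeval_def]
    refine (esymm_isHomogeneous' ℂ j).eval₂ _ _ (fun a ↦ ?_) (fun i ↦ isHomogeneous_X_pow _ _)
    rw [MvPolynomial.algebraMap_eq]
    exact isHomogeneous_C _ a

/-- **Aoki's `Y` meets the open torus of `ℙᵖ`**: with `ξ = e^{2πi/m}` (`m = pd`) and `t` a `p`-th
root of `c·∏_{j<p} ξʲ`, the point `(1 : ξ : ξ² : ⋯ : ξ^{p-1} : t)` satisfies the equations (2.1)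
(`x_jᵈ = ωʲ`, `ω = ξᵈ` a primitive `p`-th root of unity, so `e_k(x₀ᵈ, …, x_{p-1}ᵈ) = 0` for
`0 < k < p`, Vieta). In print: the points `P_t = (1 : ξᵗ : ξ²ᵗ : ⋯)` of `Y`, p. 390.
[cite: Aoki1987, proof of Prop. 3-1 (ii) (p. 390)] -/
theorem exists_eval_aokiEquations_eq_zero (hr : 0 < r) (hd : 0 < d) (c : ℂ) :
    ∃ v : Fin (2 * r + 2) → ℂ, v (Fin.castSucc 0) ≠ 0 ∧
      ∀ g ∈ aokiEquations r d c, MvPolynomial.eval v g = 0 := by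
  have hp0 : 0 < 2 * r + 1 := by omega
  have hm0 : (2 * r + 1) * d ≠ 0 := (Nat.mul_pos hp0 hd).ne'
  have hξ := Complex.isPrimitiveRoot_exp ((2 * r + 1) * d) hm0
  set ξ : ℂ := Complex.exp (2 * Real.pi * Complex.I / (((2 * r + 1) * d : ℕ) : ℂ)) with hξdef
  have hω : IsPrimitiveRoot (ξ ^ d) (2 * r + 1) :=
    hξ.pow (Nat.pos_of_ne_zero hm0) (Nat.mul_comm (2 * r + 1) d)
  obtain ⟨t, ht⟩ := IsAlgClosed.exists_pow_nat_eq (c * ∏ j : Fin (2 * r + 1), ξ ^ (j : ℕ)) hp0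
  refine ⟨Fin.snoc (α := fun _ ↦ ℂ) (fun j : Fin (2 * r + 1) ↦ ξ ^ (j : ℕ)) t, by simp, ?_⟩
  intro g hg
  rcases Set.mem_insert_iff.mp hg with rfl | hg'
  · simp only [map_sub, map_pow, map_mul, MvPolynomial.eval_X, MvPolynomial.eval_C, map_prod,
      Fin.snoc_last, Fin.snoc_castSucc]
    rw [ht, sub_self]
  · obtain ⟨j, hj, rfl⟩ := hg'
    rw [← MvPolynomial.aeval_eq_eval, MvPolynomial.comp_aeval_apply, MvPolynomial.aeval_esymm_eq_multiset_esymm]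
    have hfun : (fun i : Fin (2 * r + 1) ↦ (MvPolynomial.aeval
        (Fin.snoc (α := fun _ ↦ ℂ) (fun j : Fin (2 * r + 1) ↦ ξ ^ (j : ℕ)) t))
          ((X (Fin.castSucc i) : MvPolynomial (Fin (2 * r + 2)) ℂ) ^ d)) =
        fun i : Fin (2 * r + 1) ↦ (ξ ^ d) ^ (i : ℕ) := by
      funext i
      rw [map_pow, MvPolynomial.aeval_X, Fin.snoc_castSucc, ← pow_mul, mul_comm, pow_mul]
    rw [hfun]
    exact esymm_pow_primitiveRoot_eq_zero hω hj.1 (by have := hj.2; omega)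

/-- **PROP. 3-1, dimension lower bound: `Y ∩ X^{p-1}ₘ` has an `r`-dimensional point** (`m = pd`,
`cᵈ = -p`, `d ≥ 1`, `r ≥ 1`): `Y ⊆ ℙᵖ` is cut out by the `r + 1` forms (2.1) and is non-empty, so by
the projective dimension theorem it has a point `w` of dimension `≥ p - (r + 1) = r`
(`exists_specializes_le_height_of_mem_zeroLocus`); `w ∈ V₊(Σ xᵢᵐ) = X^{p-1}ₘ` (Prop. 3-1 (i),
`aokiSubvariety_subset_zeroLocus_fermatPolynomial`), where dimensions of closures are the same
(`height_base_eq_of_isClosedImmersion'`), and every point of `Y ∩ X` has dimension `≤ r`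
(`height_le`: `codim ≥ r`, `Aoki1987.le_coheight_of_mem_fermatAokiSection`). Together with
`le_coheight_of_mem_fermatAokiSection` this is "`Y` … of codimension `r`" of Thm. 2-1 / Prop. 3-1 at
the generic points of the top-dimensional components. [cite: Aoki1987, Thm. 2-1 (p. 388) and Prop. 3-1 (p. 389)]
[cite: Hartshorne1977, I Thm. 7.2] -/
theorem exists_mem_fermatAokiSection_height_eq (hr : 0 < r) (hd : 0 < d) (hm : m = (2 * r + 1) * d)
    {c : ℂ} (hc : c ^ d = -((2 * r + 1 : ℕ) : ℂ)) :
    ∃ z : ↥(fermatHypersurface (2 * r) m).left, z ∈ fermatAokiSection m r d c ∧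
      Order.height z = (r : ℕ∞) ∧ Order.coheight z = (r : ℕ∞) := by
  classical
  letI := MvPolynomial.gradedAlgebra (σ := Fin (2 * r + 1 + 1)) (R := ℂ)
  let 𝒜 := MvPolynomial.homogeneousSubmodule (Fin (2 * r + 1 + 1)) ℂ
  -- the explicit point of `Y` in the chart `D₊(x₀)`
  obtain ⟨v, hv0, hv⟩ := exists_eval_aokiEquations_eq_zero hr hd c
  have hvne : v ≠ 0 := Function.ne_iff.mpr ⟨Fin.castSucc 0, by simpa using hv0⟩
  let P := Literature.NumberTheory.Transcendental.pointOfVec (2 * r + 1) v hvne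
  have hPmem : ∀ {g : MvPolynomial (Fin (2 * r + 2)) ℂ} {e : ℕ}, 0 < e → g ∈ 𝒜 e →
      (g ∈ (P.pt : ProjectiveSpectrum 𝒜).asHomogeneousIdeal ↔ MvPolynomial.eval v g = 0) := by
    intro g e he hge
    have key := Literature.NumberTheory.Transcendental.pt_pointOfVec_mem_basicOpen_iff (2 * r + 1) v hvne he hge
    have key' : g ∉ (P.pt : ProjectiveSpectrum 𝒜).asHomogeneousIdeal ↔ MvPolynomial.eval v g ≠ 0 := key
    exact not_iff_not.mp key'
  have hP : P.pt ∈ aokiSubvariety r d c := by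
    refine (ProjectiveSpectrum.mem_zeroLocus _ _ _).2 fun g hg ↦ ?_
    obtain ⟨e, he, hge⟩ := exists_isHomogeneous_of_mem_aokiEquations hd c hg
    exact (hPmem he ((mem_homogeneousSubmodule e g).mpr hge)).2 (hv g hg)
  have hPx : (X (Fin.castSucc 0) : MvPolynomial (Fin (2 * r + 2)) ℂ) ∉
      (P.pt : ProjectiveSpectrum 𝒜).asHomogeneousIdeal := by
    rw [hPmem one_pos (isHomogeneous_X ℂ _), MvPolynomial.eval_X]
    exact hv0
  -- the equations as a finset of `r + 1` forms
  let S : Finset (MvPolynomial (Fin (2 * r + 2)) ℂ) :=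
    insert (X (Fin.last (2 * r + 1)) ^ (2 * r + 1) - C c * ∏ i : Fin (2 * r + 1), X (Fin.castSucc i))
      ((Finset.Icc 1 r).image fun j ↦ aeval (fun i : Fin (2 * r + 1) ↦
        (X (Fin.castSucc i) : MvPolynomial (Fin (2 * r + 2)) ℂ) ^ d) (esymm (Fin (2 * r + 1)) ℂ j))
  have hS : (S : Set (MvPolynomial (Fin (2 * r + 2)) ℂ)) = aokiEquations r d c := by
    simp only [S, Finset.coe_insert, Finset.coe_image, Finset.coe_Icc, aokiEquations]
  have hScard : S.card ≤ r + 1 := by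
    refine (Finset.card_insert_le _ _).trans ?_
    refine Nat.succ_le_succ (Finset.card_image_le.trans ?_)
    rw [Nat.card_Icc]; omega
  -- degrees
  choose! e he using fun g (hg : g ∈ aokiEquations r d c) ↦ exists_isHomogeneous_of_mem_aokiEquations hd c hg
  -- the projective dimension theorem
  have hP' : P.pt ∈ ProjectiveSpectrum.zeroLocus 𝒜 (S : Set (MvPolynomial (Fin (2 * r + 2)) ℂ)) := by
    rw [hS]; exact hP
  obtain ⟨w, hwS, -, hwh⟩ := exists_specializes_le_height_of_mem_zeroLocus S e
    (fun g hg ↦ he g (hS ▸ (Finset.mem_coe.mpr hg))) (Fin.castSucc 0) hP' hPx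
  rw [hS] at hwS
  -- `w ∈ V₊(Σ xᵢᵐ)`, the image of `X^{p-1}ₘ`
  have hwF : w ∈ Set.range (SmoothHypersurface.hypersurfaceι (fermatPolynomial ℂ (2 * r) m)).left :=
    by rw [SmoothHypersurface.range_hypersurfaceι]
       exact aokiSubvariety_subset_zeroLocus_fermatPolynomial r d hm c hc hwS
  obtain ⟨z, hz⟩ := hwF
  have hzY : z ∈ fermatAokiSection m r d c := by
    change (SmoothHypersurface.hypersurfaceι (fermatPolynomial ℂ (2 * r) m)).left.base z ∈ aokiSubvariety r d c
    rw [show (SmoothHypersurface.hypersurfaceι (fermatPolynomial ℂ (2 * r) m)).left.base z = w from hz]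
    exact hwS
  have hzh : Order.height z = Order.height w := by
    rw [← hz]; exact (Motives.height_base_eq_of_isClosedImmersion' _ z).symm
  -- `height z = r`: `≥ r` from the dimension theorem, `≤ r` from `codim ≥ r`
  have hmpos : 1 ≤ m := by rw [hm]; exact Nat.mul_pos (by omega) hd
  -- `dim + codim = 2r` on the smooth irreducible `X²ʳₘ`
  have hsum : Order.height z + Order.coheight z = (2 * r : ℕ) := by
    have hX : IsSmoothProjective (2 * r) (fermatHypersurface (2 * r) m) :=
      isSmoothProjective_fermatHypersurface (by omega) hmpos
    haveI := hX.smoothOfRelativeDimension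
    haveI := hX.geometricallyIrreducible
    haveI : IrreducibleSpace ↥(fermatHypersurface (2 * r) m).left :=
      GeometricallyIrreducible.irreducibleSpace_of_subsingleton (fermatHypersurface (2 * r) m).hom
    exact Motives.height_add_coheight_eq_of_smoothOfRelativeDimension (fermatHypersurface (2 * r) m).hom
      (2 * r) z
  have hco : (r : ℕ∞) ≤ Order.coheight z := le_coheight_of_mem_fermatAokiSection hmpos hd c hzY
  have hge : (r : ℕ∞) ≤ Order.height z := by
    rw [hzh]; refine le_trans ?_ hwh; exact_mod_cast (show r ≤ 2 * r + 1 - S.card by omega)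
  refine ⟨z, hzY, ?_⟩
  -- arithmetic in `ℕ∞`
  have hfin : Order.height z ≠ ⊤ :=
    (lt_of_le_of_lt (le_self_add.trans hsum.le) (ENat.coe_lt_top _)).ne
  have hfin' : Order.coheight z ≠ ⊤ :=
    (lt_of_le_of_lt (le_add_self.trans hsum.le) (ENat.coe_lt_top _)).ne
  obtain ⟨a, ha⟩ := ENat.ne_top_iff_exists.mp hfin
  obtain ⟨b, hb⟩ := ENat.ne_top_iff_exists.mp hfin'
  rw [← ha, ← hb] at hsum ⊢
  rw [← ha] at hge
  rw [← hb] at hco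
  have h1 : a + b = 2 * r := by exact_mod_cast hsum
  have h2 : r ≤ a := by exact_mod_cast hge
  have h3 : r ≤ b := by exact_mod_cast hco
  exact ⟨by exact_mod_cast (show a = r by omega), by exact_mod_cast (show b = r by omega)⟩

end Aoki1987

end Literature.AlgebraicGeometry.HodgeTheory

end
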